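import Literature.MathematicalPhysics.QuantumLattice.FermionGammaFunctorTrace
import Literature.MathematicalPhysics.QuantumLattice.BdGBondHamiltonianParticleHole
import HarnessLib

/-!
# The free-fermion partition function of an EXACTLY DIAGONALISED one-body matrix:
# `Tr e^{−β(dΓ(Q D Q⁻¹) + c)} = e^{−βc} ∏_k (1 + e^{−β d_k})` and its logarithm

Topic `MathematicalPhysics/QuantumLattice`; a corollary of the tree's free-fermion trace formula
`Tr e^{−β dΓ(h)} = det(1 + e^{−βh})` (`partitionFn_dGamma_eq_det_of_any`, `FermionGammaFunctorTrace.lean`,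
after Dereziński–Gérard §17.2.4) in the form the thermal-SDP producers' «ent-gauss» rows use it: their
quadratic entropy witness on a box is `Ĝ = dΓ(g) + LZ·1` with `g = Q diag(d) Q⁻¹` diagonalised EXACTLY
(rational Cayley factor `Q`, dyadic spectrum `d`), and the constant of the row is `log Tr e^{−Ĝ}`, which
must be computed without touching the `2^{|modes|}`-dimensional Fock space:

* `partitionFn_dGamma_conj_diagonal` — `Tr e^{−β dΓ(Q diag(d) Q⁻¹)} = ∏_k (1 + e^{−β d_k})` for every
  invertible `Q` and real `d`;
* `partitionFn_dGamma_conj_diagonal_add_smul_one` — with the identity shift: `· e^{−βc}`;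
* `log_re_partitionFn_one_dGamma_conj_diagonal_add_smul_one` —
  `log Re Tr e^{−(dΓ(Q diag d Q⁻¹) + c·1)} = −c + Σ_k log(1 + e^{−d_k})`, and the «LZ lemma»
  `log Re Tr e^{−Ĝ} ≤ 0` whenever `Σ_k log(1 + e^{−d_k}) ≤ c`
  (`log_re_partitionFn_one_dGamma_conj_diagonal_add_smul_one_nonpos`).

Everything is PROVED; no definition, no named fact.

References: J. Dereziński, C. Gérard, *Mathematics of Quantization and Quantum Fields* (2nd ed. 2022)
§17.2.4 (Prop. 17.37, `Tr Γ(γ) = det(1 + γ)`) [DerezinskiGerard2022]; O. Bratteli, D. W. Robinson,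
OAQSM 2 §5.2.1 (quasi-free / gauge-invariant states) [BratteliRobinsonII1997].
-/

noncomputable section

namespace Literature.MathematicalPhysics.QuantumLattice

open Matrix Finset NormedSpace

variable {ι : Type*} [LinearOrder ι] [Fintype ι]

/-- `1 + e^{−β diag(d)} = diag(1 + e^{−β d_k})`. [folklore] -/
private theorem one_add_exp_neg_smul_diagonal (β : ℝ) (d : ι → ℝ) :
    (1 : Matrix ι ι ℂ) + exp (-(β : ℂ) • diagonal (fun k => ((d k : ℝ) : ℂ))) =
      diagonal fun k => (((1 + Real.exp (-(β * d k)) : ℝ)) : ℂ) := by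
  rw [← diagonal_smul, Matrix.exp_diagonal, ← diagonal_one, diagonal_add]
  congr 1
  funext k
  simp only [Pi.exp_def, Pi.smul_apply, smul_eq_mul]
  rw [← Complex.exp_eq_exp_ℂ]
  push_cast
  rw [neg_mul]

/-- **Free partition function of an exactly diagonalised one-body matrix**: for invertible `Q`, real `d`
and real `β`, `Tr e^{−β dΓ(Q diag(d) Q⁻¹)} = ∏_k (1 + e^{−β d_k})` (trace formula `= det(1 + e^{−βh})`,
conjugation invariance of `exp` and `det`). [cite: DerezinskiGerard2022, §17.2.4 (proof of Prop. 17.37)] -/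
theorem partitionFn_dGamma_conj_diagonal (β : ℝ) {Q : Matrix ι ι ℂ} (hQ : IsUnit Q) (d : ι → ℝ) :
    partitionFn β (dGamma (Q * diagonal (fun k => ((d k : ℝ) : ℂ)) * Q⁻¹)) =
      ∏ k, (((1 + Real.exp (-(β * d k)) : ℝ)) : ℂ) := by
  rw [partitionFn_dGamma_eq_det_of_any]
  have hsmul : -(β : ℂ) • (Q * diagonal (fun k => ((d k : ℝ) : ℂ)) * Q⁻¹) =
      Q * (-(β : ℂ) • diagonal (fun k => ((d k : ℝ) : ℂ))) * Q⁻¹ := by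
    rw [Matrix.mul_smul, Matrix.smul_mul]
  rw [hsmul, Matrix.exp_conj _ _ hQ]
  have h1 : (1 : Matrix ι ι ℂ) + Q * exp (-(β : ℂ) • diagonal (fun k => ((d k : ℝ) : ℂ))) * Q⁻¹ =
      Q * (1 + exp (-(β : ℂ) • diagonal (fun k => ((d k : ℝ) : ℂ)))) * Q⁻¹ := by
    rw [Matrix.mul_add, Matrix.add_mul, Matrix.mul_one,
      Matrix.mul_nonsing_inv _ ((Matrix.isUnit_iff_isUnit_det Q).mp hQ)]
  rw [h1, Matrix.det_conj hQ, one_add_exp_neg_smul_diagonal, det_diagonal]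

/-- With an identity shift `c·1` (a constant in the witness): `Tr e^{−β(dΓ(Q diag d Q⁻¹) + c·1)} =
e^{−βc} ∏_k (1 + e^{−β d_k})`. [cite: DerezinskiGerard2022, §17.2.4 (proof of Prop. 17.37)] -/
theorem partitionFn_dGamma_conj_diagonal_add_smul_one (β : ℝ) {Q : Matrix ι ι ℂ} (hQ : IsUnit Q)
    (d : ι → ℝ) (c : ℝ) :
    partitionFn β (dGamma (Q * diagonal (fun k => ((d k : ℝ) : ℂ)) * Q⁻¹) +
        ((c : ℝ) : ℂ) • (1 : Matrix (Finset ι) (Finset ι) ℂ)) =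
      (((Real.exp (-(β * c)) * ∏ k, (1 + Real.exp (-(β * d k))) : ℝ)) : ℂ) := by
  rw [partitionFn, gibbsWeight_add_smul_one, trace_smul, smul_eq_mul, ← partitionFn,
    partitionFn_dGamma_conj_diagonal β hQ d]
  push_cast
  rw [neg_mul]

/-- **The logarithm of the constant of a quadratic entropy witness**: at `β = 1`,
`log Re Tr e^{−(dΓ(Q diag d Q⁻¹) + c·1)} = −c + Σ_k log(1 + e^{−d_k})`.
[cite: DerezinskiGerard2022, §17.2.4 (proof of Prop. 17.37)] -/
theorem log_re_partitionFn_one_dGamma_conj_diagonal_add_smul_one {Q : Matrix ι ι ℂ} (hQ : IsUnit Q)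
    (d : ι → ℝ) (c : ℝ) :
    Real.log (partitionFn 1 (dGamma (Q * diagonal (fun k => ((d k : ℝ) : ℂ)) * Q⁻¹) +
        ((c : ℝ) : ℂ) • (1 : Matrix (Finset ι) (Finset ι) ℂ))).re =
      -c + ∑ k, Real.log (1 + Real.exp (-d k)) := by
  rw [partitionFn_dGamma_conj_diagonal_add_smul_one 1 hQ d c, Complex.ofReal_re]
  simp only [one_mul]
  have hpos : ∀ k, 0 < 1 + Real.exp (-d k) := fun k => by positivity
  rw [Real.log_mul (Real.exp_pos _).ne' (Finset.prod_pos fun k _ => hpos k).ne', Real.log_exp,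
    Real.log_prod fun k _ => (hpos k).ne']

/-- **The «LZ lemma» of the ent-gauss rows**: if `Σ_k log(1 + e^{−d_k}) ≤ c` then
`log Re Tr e^{−(dΓ(Q diag d Q⁻¹) + c·1)} ≤ 0` (so the constant of the entropy row can be taken `0`).
[cite: DerezinskiGerard2022, §17.2.4 (proof of Prop. 17.37)] -/
theorem log_re_partitionFn_one_dGamma_conj_diagonal_add_smul_one_nonpos {Q : Matrix ι ι ℂ} (hQ : IsUnit Q)
    (d : ι → ℝ) {c : ℝ} (hc : ∑ k, Real.log (1 + Real.exp (-d k)) ≤ c) :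
    Real.log (partitionFn 1 (dGamma (Q * diagonal (fun k => ((d k : ℝ) : ℂ)) * Q⁻¹) +
        ((c : ℝ) : ℂ) • (1 : Matrix (Finset ι) (Finset ι) ℂ))).re ≤ 0 := by
  rw [log_re_partitionFn_one_dGamma_conj_diagonal_add_smul_one hQ d c]
  linarith

end Literature.MathematicalPhysics.QuantumLattice

end
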